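import Summits.QuantumFields.YangMills.Theorems.PencilRigidityWeakCouplingHypercubicLimitStubTransferRepresentation
import HarnessLib

/-!
# Crux `IR` (stmt-QuantumFields-19354), line `ym-ir7-volume-monotone-gap` (ideator ym-ir-idea-7), input T-GAP-FINITE-sc —
# part 2a: torus expectations of time-slice observables are cyclic slice-chain integrals (the facing-plaquette covariance)

Helper module for item `stmt-QuantumFields-19354` (`--supports … --as helper`; closes nothing by itself).  Pooled prover
ym-ir-line-pool-p3 (g5).  For a `LatticeRep r` of a compact group `G` and the symmetric torus `(ℤ/N)⁴` sliced across the time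
direction `0` (tree: `stub_timeSlicing` — the assembling map `(Us, gs) ↦ U` is measure preserving and splits the Wilson action into
`Σ_t (S₃(U_t) + S_tm(U_t, g_t, U_{t+1}))`):

* `integral_wilsonMeasure_eq_sliced` — `∫ Φ dμ_W = (∫ Φ(asm p) ∏_t c_t(p)) / (∫ ∏_t c_t(p))` with the symmetrised one-step factors
  `c_t = e^{−βS₃(U_t)/2} e^{−βS_tm(U_t,g_t,U_{t+1})} e^{−βS₃(U_{t+1})/2}` (verbatim the first step of `stub_transferRepresentation`);
* `integral_sliceFun_prod_factor` — Fubini over the temporal links: for a functional `Ψ` of the spatial slices only,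
  `∫ Ψ(p.1) ∏_t c_t(p) = ∫ Ψ(V) ∏_t K_β(V_t, V_{t+1}) dV`, `K_β = wilsonSliceKernel` (the Gauss-law integrals factorise);
* `integral_wilsonMeasure_sliceFun` — hence `∫ Ψ(slices U) dμ_W(U) = (∫ Ψ(V) ∏_t K_β(V_t,V_{t+1}) dV) / cyclicPartition r.ρ β N N`;
* `integral_cyclic_rotate` — rotating the time cycle does not change a cyclic slice-chain integral;
* `facingPlaquette_fst/snd_eq` — the two facing plaquette observables `Re tr ρ(U_{(0;1,2)})`, `Re tr ρ(U_{(e₀;1,2)})` of the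
  `SCFloor` engine are the spatial plaquette `f(V) = Re tr ρ(V_{(0;0,1)})` read on the slices `t = 0`, `t = 1`;
* `facingCov_eq_cyclic` — **the facing-plaquette covariance of the torus Wilson state is the lag-one covariance of the cyclic
  slice chain**: `Cov_W(P₀, P₁) = I/Z − (J/Z)²` with `I = ∫ ∏K · f(V₀)f(V₁)`, `J = ∫ ∏K · f(V₀)`, `Z = cyclicPartition r.ρ β N N`.

Part 2b (`VolumeMonotoneTraceExcessFloor`) combines this with the abstract floor (parts 1a/1b), the tree's volume-uniform
facing-plaquette floor `SCFloor.facingPlaquetteCorr_floor_latticeRep` and the rate-tracking strong-coupling cold-pressure bound.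

HONEST FRAMING: Osterwalder–Seiler slicing bookkeeping on a finite torus; nothing here bears on weak coupling, `BalabanLadder.IR`, or the
Yang–Mills mass gap (Clay); R4 of the ladder closes only the conditional finite-𝕋⁴ rung `BalabanLadder.UV`.
Refs: K. Osterwalder, E. Seiler, Ann. Phys. 110 (1978) 440, §§2–3; I. Montvay, G. Münster, *Quantum Fields on a Lattice* (1994),
§3.2.6 (3.139)–(3.145).
-/

set_option autoImplicit false

noncomputable section

open MeasureTheory Filter Function
open Literature.MathematicalPhysics.QuantumFieldTheory
open Summit.QuantumFields.YangMills.Theorems.WeakCouplingHypercubicLimit.TraceNormColdPressure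
  (stub_timeSlicing stub_sliceKernel integral_rotate_cycle prod_rotate_cycle exp_neg_mul_sum_eq_prod)

namespace Summit.QuantumFields.YangMills.Cruxes.IR.VolumeMonotone.SliceBridge

variable {G : Type} [Group G] [TopologicalSpace G] [IsTopologicalGroup G] [CompactSpace G]
  [MeasurableSpace G] [BorelSpace G]

/-! ## §1 Slicing the torus Wilson state across time (first step of `stub_transferRepresentation`, isolated) -/

/-- **Torus expectations through the time slicing.**  For a measurable `Φ` on the configurations of `(ℤ/N)⁴`:
`∫ Φ dμ_W = (∫ Φ(asm p) ∏_t c_t(p) d(Us, gs)) / ∫ ∏_t c_t(p) d(Us, gs)`, `asm` the assembling map of `stub_timeSlicing` and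
`c_t(p) = e^{−βS₃(U_t)/2} e^{−βS_tm(U_t,g_t,U_{t+1})} e^{−βS₃(U_{t+1})/2}` the symmetrised one-step factor. [folklore] -/
theorem integral_wilsonMeasure_eq_sliced (r : LatticeRep G) (β : ℝ) (N : ℕ) [NeZero N]
    (Φ : GaugeConfig 4 N G → ℝ) (hΦ : Measurable Φ) :
    ∫ U, Φ U ∂(wilsonMeasure (d := 4) (L := N) r.ρ β) =
      (∫ p : (ZMod N → GaugeConfig 3 N G) × (ZMod N → Site 3 N → G),
          Φ (fun e : Edge 4 N =>
              (Fin.cons (p.2 (e.1 0) (Fin.tail e.1)) (fun i : Fin 3 => p.1 (e.1 0) (Fin.tail e.1, i)) : Fin 4 → G) e.2) *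
            ∏ t : ZMod N, (Real.exp (-(β * wilsonAction r.ρ (p.1 t) / 2)) *
              Real.exp (-(β * sliceTemporalAction r.ρ (p.1 t) (p.2 t) (p.1 (t + 1)))) *
              Real.exp (-(β * wilsonAction r.ρ (p.1 (t + 1)) / 2)))
          ∂((Measure.pi fun _ : ZMod N => Measure.pi fun _ : Edge 3 N => haarProbability G).prod
            (Measure.pi fun _ : ZMod N => Measure.pi fun _ : Site 3 N => haarProbability G))) /
        ∫ p : (ZMod N → GaugeConfig 3 N G) × (ZMod N → Site 3 N → G),
          ∏ t : ZMod N, (Real.exp (-(β * wilsonAction r.ρ (p.1 t) / 2)) *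
              Real.exp (-(β * sliceTemporalAction r.ρ (p.1 t) (p.2 t) (p.1 (t + 1)))) *
              Real.exp (-(β * wilsonAction r.ρ (p.1 (t + 1)) / 2)))
          ∂((Measure.pi fun _ : ZMod N => Measure.pi fun _ : Edge 3 N => haarProbability G).prod
            (Measure.pi fun _ : ZMod N => Measure.pi fun _ : Site 3 N => haarProbability G)) := by
  haveI : SecondCountableTopology G :=
    (r.continuous.isClosedEmbedding r.injective).isEmbedding.secondCountableTopology
  set asm : (ZMod N → GaugeConfig 3 N G) × (ZMod N → Site 3 N → G) → GaugeConfig 4 N G := fun p => fun e : Edge 4 N =>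
    (Fin.cons (p.2 (e.1 0) (Fin.tail e.1)) (fun i : Fin 3 => p.1 (e.1 0) (Fin.tail e.1, i)) : Fin 4 → G) e.2 with hasm_def
  obtain ⟨hasm, hact⟩ := stub_timeSlicing N G r.ρ
  have hasm_meas : Measurable asm := hasm.measurable
  have hact' : ∀ p : (ZMod N → GaugeConfig 3 N G) × (ZMod N → Site 3 N → G),
      wilsonAction r.ρ (asm p) = ∑ t : ZMod N, (wilsonAction r.ρ (p.1 t) + sliceTemporalAction r.ρ (p.1 t) (p.2 t) (p.1 (t + 1))) :=
    fun p => hact p.1 p.2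
  have hnum : ∀ Ψ : GaugeConfig 4 N G → ℝ, Measurable Ψ →
      ∫ U, Ψ U * Real.exp (-β * wilsonAction r.ρ U) ∂(Measure.pi fun _ : Edge 4 N => haarProbability G) =
        ∫ p, Ψ (asm p) * ∏ t : ZMod N, (Real.exp (-(β * wilsonAction r.ρ (p.1 t) / 2)) *
            Real.exp (-(β * sliceTemporalAction r.ρ (p.1 t) (p.2 t) (p.1 (t + 1)))) *
            Real.exp (-(β * wilsonAction r.ρ (p.1 (t + 1)) / 2)))
          ∂((Measure.pi fun _ : ZMod N => Measure.pi fun _ : Edge 3 N => haarProbability G).prod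
            (Measure.pi fun _ : ZMod N => Measure.pi fun _ : Site 3 N => haarProbability G)) := by
    intro Ψ hΨ
    have hmeas : Measurable fun U : GaugeConfig 4 N G => Ψ U * Real.exp (-β * wilsonAction r.ρ U) :=
      hΨ.mul (Real.measurable_exp.comp ((measurable_wilsonAction r.ρ r.continuous).const_mul (-β)))
    rw [← hasm.map_eq, integral_map hasm_meas.aemeasurable hmeas.aestronglyMeasurable]
    refine integral_congr_ae (ae_of_all _ fun p => ?_)
    dsimp only
    rw [hact' p, exp_neg_mul_sum_eq_prod]
  have h := wilsonExpectation_eq_div_integral (L := N) (ρ := r.ρ) r.continuous β Φ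
  unfold wilsonExpectation at h
  rw [h, hnum Φ hΦ]
  have h1 := hnum (fun _ => (1 : ℝ)) measurable_const
  simp only [one_mul] at h1
  rw [h1]

/-- **Fubini over the second factor of a cyclic two-species chain (abstract).**  For a measurable one-step factor
`c : X × Y × X → [0, 1]` and a bounded measurable functional `Ψ` of the `X`-chain only:
`∫ Ψ(p.1) ∏_t c(p.1 t, p.2 t, p.1 (t+1)) d(μ^{⊗N} ⊗ ν^{⊗N}) = ∫ Ψ(V) ∏_t (∫ c(V t, y, V (t+1)) dν(y)) dμ^{⊗N}(V)`. [folklore] -/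
theorem integral_prod_cyclic_factor {X Y : Type*} [MeasurableSpace X] [MeasurableSpace Y] (μ : Measure X) (ν : Measure Y)
    [IsProbabilityMeasure μ] [IsProbabilityMeasure ν] {N : ℕ} [NeZero N] (c : X → Y → X → ℝ)
    (hc : Measurable fun q : X × Y × X => c q.1 q.2.1 q.2.2) (hc01 : ∀ x y x', 0 ≤ c x y x' ∧ c x y x' ≤ 1)
    (Ψ : (ZMod N → X) → ℝ) (hΨ : Measurable Ψ) {B : ℝ} (hΨb : ∀ V, ‖Ψ V‖ ≤ B) :
    ∫ p : (ZMod N → X) × (ZMod N → Y), Ψ p.1 * ∏ t : ZMod N, c (p.1 t) (p.2 t) (p.1 (t + 1))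
        ∂((Measure.pi fun _ : ZMod N => μ).prod (Measure.pi fun _ : ZMod N => ν)) =
      ∫ V : ZMod N → X, Ψ V * ∏ t : ZMod N, (∫ y, c (V t) y (V (t + 1)) ∂ν) ∂(Measure.pi fun _ : ZMod N => μ) := by
  -- measurability and bounds of the integrand on the product space
  have hfac : ∀ t : ZMod N, Measurable fun p : (ZMod N → X) × (ZMod N → Y) => c (p.1 t) (p.2 t) (p.1 (t + 1)) := by
    intro t
    have hτ : Measurable fun p : (ZMod N → X) × (ZMod N → Y) => (p.1 t, p.2 t, p.1 (t + 1)) :=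
      ((measurable_pi_apply t).comp measurable_fst).prodMk
        (((measurable_pi_apply t).comp measurable_snd).prodMk ((measurable_pi_apply (t + 1)).comp measurable_fst))
    exact hc.comp hτ
  have hF_meas : Measurable fun p : (ZMod N → X) × (ZMod N → Y) => Ψ p.1 * ∏ t : ZMod N, c (p.1 t) (p.2 t) (p.1 (t + 1)) :=
    (hΨ.comp measurable_fst).mul (Finset.measurable_prod _ fun t _ => hfac t)
  have hB : 0 ≤ max B 0 := le_max_right _ _
  have hF_bd : ∀ p : (ZMod N → X) × (ZMod N → Y), ‖Ψ p.1 * ∏ t : ZMod N, c (p.1 t) (p.2 t) (p.1 (t + 1))‖ ≤ max B 0 := by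
    intro p
    rw [norm_mul, Real.norm_eq_abs (∏ t : ZMod N, _), abs_of_nonneg (Finset.prod_nonneg fun t _ => (hc01 _ _ _).1)]
    calc ‖Ψ p.1‖ * ∏ t : ZMod N, c (p.1 t) (p.2 t) (p.1 (t + 1)) ≤ max B 0 * 1 :=
          mul_le_mul ((hΨb _).trans (le_max_left _ _))
            (Finset.prod_le_one (fun t _ => (hc01 _ _ _).1) fun t _ => (hc01 _ _ _).2)
            (Finset.prod_nonneg fun t _ => (hc01 _ _ _).1) hB
      _ = max B 0 := mul_one _
  have hint : Integrable (fun p : (ZMod N → X) × (ZMod N → Y) => Ψ p.1 * ∏ t : ZMod N, c (p.1 t) (p.2 t) (p.1 (t + 1)))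
      ((Measure.pi fun _ : ZMod N => μ).prod (Measure.pi fun _ : ZMod N => ν)) :=
    (integrable_const (max B 0)).mono' hF_meas.aestronglyMeasurable (Eventually.of_forall hF_bd)
  rw [integral_prod _ hint]
  refine integral_congr_ae (Eventually.of_forall fun V => ?_)
  dsimp only
  rw [integral_const_mul]
  congr 1
  exact integral_fintype_prod_eq_prod (𝕜 := ℝ) (μ := fun _ : ZMod N => ν) (fun (t : ZMod N) (y : Y) => c (V t) y (V (t + 1)))

/-- **Fubini over the temporal links.**  For a bounded measurable functional `Ψ` of the spatial slices, the Gauss-law integrals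
factorise slab by slab: `∫ Ψ(p.1) ∏_t c_t(p) d(Us, gs) = ∫ Ψ(V) ∏_t K_β(V_t, V_{t+1}) dV`, `K_β = wilsonSliceKernel`. [folklore] -/
theorem integral_sliceFun_stepFactor (r : LatticeRep G) {β : ℝ} (hβ : 0 ≤ β) (N : ℕ) [NeZero N]
    (Ψ : (ZMod N → GaugeConfig 3 N G) → ℝ) (hΨ : Measurable Ψ) {B : ℝ} (hΨb : ∀ V, ‖Ψ V‖ ≤ B) :
    ∫ p : (ZMod N → GaugeConfig 3 N G) × (ZMod N → Site 3 N → G),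
        Ψ p.1 * ∏ t : ZMod N, (Real.exp (-(β * wilsonAction r.ρ (p.1 t) / 2)) *
            Real.exp (-(β * sliceTemporalAction r.ρ (p.1 t) (p.2 t) (p.1 (t + 1)))) *
            Real.exp (-(β * wilsonAction r.ρ (p.1 (t + 1)) / 2)))
        ∂((Measure.pi fun _ : ZMod N => Measure.pi fun _ : Edge 3 N => haarProbability G).prod
          (Measure.pi fun _ : ZMod N => Measure.pi fun _ : Site 3 N => haarProbability G)) =
      ∫ V : ZMod N → GaugeConfig 3 N G, Ψ V * ∏ t : ZMod N, wilsonSliceKernel r.ρ β (V t) (V (t + 1))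
        ∂(Measure.pi fun _ : ZMod N => Measure.pi fun _ : Edge 3 N => haarProbability G) := by
  haveI : SecondCountableTopology G :=
    (r.continuous.isClosedEmbedding r.injective).isEmbedding.secondCountableTopology
  haveI : IsProbabilityMeasure (haarProbability G) :=
    Literature.RepresentationTheory.CompactGroups.CompactGroup.isProbabilityMeasure_haarMeasure_top
  obtain ⟨hk_meas, hk_le, hs_meas, hs_le, -, -, -, -⟩ := stub_sliceKernel G r N β hβ
  -- the one-step factor as an abstract three-slot function
  have hc_meas : Measurable fun q : GaugeConfig 3 N G × (Site 3 N → G) × GaugeConfig 3 N G =>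
      Real.exp (-(β * wilsonAction r.ρ q.1 / 2)) * Real.exp (-(β * sliceTemporalAction r.ρ q.1 q.2.1 q.2.2)) *
        Real.exp (-(β * wilsonAction r.ρ q.2.2 / 2)) :=
    ((hs_meas.comp measurable_fst).mul hk_meas).mul (hs_meas.comp (measurable_snd.comp measurable_snd))
  have hc01 : ∀ (U : GaugeConfig 3 N G) (g : Site 3 N → G) (U' : GaugeConfig 3 N G),
      0 ≤ Real.exp (-(β * wilsonAction r.ρ U / 2)) * Real.exp (-(β * sliceTemporalAction r.ρ U g U')) *
          Real.exp (-(β * wilsonAction r.ρ U' / 2)) ∧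
        Real.exp (-(β * wilsonAction r.ρ U / 2)) * Real.exp (-(β * sliceTemporalAction r.ρ U g U')) *
          Real.exp (-(β * wilsonAction r.ρ U' / 2)) ≤ 1 := fun U g U' =>
    ⟨by positivity, mul_le_one₀ (mul_le_one₀ (hs_le U) (Real.exp_pos _).le (hk_le U g U')) (Real.exp_pos _).le (hs_le U')⟩
  have h := integral_prod_cyclic_factor (Measure.pi fun _ : Edge 3 N => haarProbability G)
    (Measure.pi fun _ : Site 3 N => haarProbability G)
    (fun (U : GaugeConfig 3 N G) (g : Site 3 N → G) (U' : GaugeConfig 3 N G) =>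
      Real.exp (-(β * wilsonAction r.ρ U / 2)) * Real.exp (-(β * sliceTemporalAction r.ρ U g U')) *
        Real.exp (-(β * wilsonAction r.ρ U' / 2))) hc_meas hc01 Ψ hΨ hΨb
  rw [h]
  refine integral_congr_ae (Eventually.of_forall fun V => ?_)
  dsimp only
  congr 1
  refine Finset.prod_congr rfl fun t _ => ?_
  unfold wilsonSliceKernel
  rw [integral_mul_const, integral_const_mul]

/-- **Torus expectation of a slice functional = normalised cyclic slice-chain integral**: for bounded measurable `Ψ`,
`∫ Ψ(slices U) dμ_W(U) = (∫ (∏_t K_β(V_t,V_{t+1})) Ψ(V) dV) / cyclicPartition r.ρ β N N`, where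
`(slices U)(t)(y, i) = U((t, y), i+1)` are the spatial slices. [folklore] -/
theorem integral_wilsonMeasure_sliceFun (r : LatticeRep G) {β : ℝ} (hβ : 0 ≤ β) (N : ℕ) [NeZero N]
    (Ψ : (ZMod N → GaugeConfig 3 N G) → ℝ) (hΨ : Measurable Ψ) {B : ℝ} (hΨb : ∀ V, ‖Ψ V‖ ≤ B) :
    ∫ U, Ψ (fun t q => U (Fin.cons t q.1, q.2.succ)) ∂(wilsonMeasure (d := 4) (L := N) r.ρ β) =
      (∫ V : ZMod N → GaugeConfig 3 N G, (∏ t : ZMod N, wilsonSliceKernel r.ρ β (V t) (V (t + 1))) * Ψ V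
          ∂(Measure.pi fun _ : ZMod N => Measure.pi fun _ : Edge 3 N => haarProbability G)) /
        cyclicPartition r.ρ β N N := by
  have hslm : Measurable fun U : GaugeConfig 4 N G => fun (t : ZMod N) (q : Edge 3 N) => U (Fin.cons t q.1, q.2.succ) :=
    measurable_pi_lambda _ fun _ => measurable_pi_lambda _ fun _ => measurable_pi_apply _
  rw [integral_wilsonMeasure_eq_sliced r β N (fun U => Ψ (fun t q => U (Fin.cons t q.1, q.2.succ))) (hΨ.comp hslm)]
  -- the observable rides on the spatial slices: `slices (asm p) = p.1`
  have hride : ∀ p : (ZMod N → GaugeConfig 3 N G) × (ZMod N → Site 3 N → G),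
      (fun (t : ZMod N) (q : Edge 3 N) => (fun e : Edge 4 N =>
        (Fin.cons (p.2 (e.1 0) (Fin.tail e.1)) (fun i : Fin 3 => p.1 (e.1 0) (Fin.tail e.1, i)) : Fin 4 → G) e.2)
          (Fin.cons t q.1, q.2.succ)) = p.1 := by
    intro p
    funext t q
    simp only [Fin.cons_zero, Fin.tail_cons, Fin.cons_succ]
  simp only [hride]
  have h1 := integral_sliceFun_stepFactor r hβ N Ψ hΨ hΨb
  have h0 := integral_sliceFun_stepFactor r hβ N (fun _ => (1 : ℝ)) measurable_const (B := 1) (fun _ => by simp)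
  simp only [one_mul] at h0
  rw [h1, h0]
  unfold cyclicPartition
  congr 1
  refine integral_congr_ae (Eventually.of_forall fun V => ?_)
  simp only [mul_comm]

/-! ## §2 Rotating the time cycle -/

/-- **Rotation invariance of cyclic slice-chain integrals**: relabelling the time cycle by a translation. [folklore] -/
theorem integral_cyclic_rotate {X : Type*} [MeasurableSpace X] (μ : Measure X) [SigmaFinite μ] {N : ℕ} [NeZero N]
    (c₀ : ZMod N) (F : (ZMod N → X) → ℝ) :
    ∫ V, F (fun τ => V (τ + c₀)) ∂(Measure.pi fun _ : ZMod N => μ) = ∫ V, F V ∂(Measure.pi fun _ : ZMod N => μ) := by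
  set eX := MeasurableEquiv.piCongrLeft (fun _ : ZMod N => X) (Equiv.addRight c₀).symm with heX
  have hX : MeasurePreserving eX (Measure.pi fun _ : ZMod N => μ) (Measure.pi fun _ : ZMod N => μ) :=
    measurePreserving_piCongrLeft (fun _ : ZMod N => μ) (Equiv.addRight c₀).symm
  have heXa : ∀ V : ZMod N → X, eX V = fun τ => V (τ + c₀) := fun V => by
    funext i
    simp only [heX, MeasurableEquiv.coe_piCongrLeft, Equiv.piCongrLeft_apply_eq_cast, cast_eq, Equiv.symm_symm,
      Equiv.coe_addRight]
  calc ∫ V, F (fun τ => V (τ + c₀)) ∂(Measure.pi fun _ : ZMod N => μ)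
      = ∫ V, F (eX V) ∂(Measure.pi fun _ : ZMod N => μ) := by simp only [heXa]
    _ = _ := hX.integral_comp' F

/-- The cyclic Boltzmann product is invariant under a translation of the time cycle. [folklore] -/
theorem prod_sliceKernel_rotate {X : Type*} {N : ℕ} [NeZero N] (K : X → X → ℝ) (c₀ : ZMod N) (V : ZMod N → X) :
    ∏ t : ZMod N, K (V (t + c₀)) (V (t + 1 + c₀)) = ∏ t : ZMod N, K (V t) (V (t + 1)) :=
  Fintype.prod_equiv (Equiv.addRight c₀) _ _ fun t => by simp only [Equiv.coe_addRight, add_right_comm]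

/-- **One-site insertions at time `1` and time `0` agree** (time-translation invariance of the cyclic chain). [folklore] -/
theorem integral_cyclic_insert_one_eq_zero {X : Type*} [MeasurableSpace X] (μ : Measure X) [SigmaFinite μ] {N : ℕ}
    [NeZero N] (K : X → X → ℝ) (f : X → ℝ) :
    ∫ V, (∏ t : ZMod N, K (V t) (V (t + 1))) * f (V 1) ∂(Measure.pi fun _ : ZMod N => μ) =
      ∫ V, (∏ t : ZMod N, K (V t) (V (t + 1))) * f (V 0) ∂(Measure.pi fun _ : ZMod N => μ) := by
  rw [← integral_cyclic_rotate μ (1 : ZMod N) (fun V => (∏ t : ZMod N, K (V t) (V (t + 1))) * f (V 0))]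
  refine integral_congr_ae (Eventually.of_forall fun V => ?_)
  dsimp only
  rw [zero_add]
  congr 1
  have h := prod_sliceKernel_rotate K (1 : ZMod N) V
  simp only [add_assoc] at h ⊢
  convert h.symm using 3

/-! ## §3 The facing plaquettes as slice observables, and the covariance formula -/

section Facing

variable {n : ℕ} (ρ : G →* Matrix (Fin n) (Fin n) ℂ)

omit [TopologicalSpace G] [IsTopologicalGroup G] [CompactSpace G] [MeasurableSpace G] [BorelSpace G] in
/-- Time-slice coordinates: the origin of `(ℤ/N)⁴` is `(0, 0⃗)`. -/
theorem site_zero_eq_cons {N : ℕ} : (0 : Site 4 N) = Fin.cons (0 : ZMod N) (0 : Site 3 N) := by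
  funext j; refine Fin.cases ?_ (fun k => ?_) j <;> simp

omit [TopologicalSpace G] [IsTopologicalGroup G] [CompactSpace G] [MeasurableSpace G] [BorelSpace G] in
/-- Time-slice coordinates: `e₀ = (1, 0⃗)`. -/
theorem site_shift_zero_eq_cons {N : ℕ} : Site.shift (0 : Site 4 N) 0 = Fin.cons (1 : ZMod N) (0 : Site 3 N) := by
  funext j; refine Fin.cases ?_ (fun k => ?_) j <;> simp [Site.shift]

omit [TopologicalSpace G] [IsTopologicalGroup G] [CompactSpace G] [MeasurableSpace G] [BorelSpace G] in
/-- Time-slice coordinates: a spatial shift acts on the spatial part. -/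
theorem cons_shift_succ {N : ℕ} (t : ZMod N) (y : Site 3 N) (i : Fin 3) :
    Site.shift (Fin.cons t y : Site 4 N) i.succ = Fin.cons t (Site.shift y i) := by
  simp only [Site.shift]
  ext j
  refine Fin.cases ?_ (fun k => ?_) j
  · simp
  · simp [Pi.single_apply]

omit [TopologicalSpace G] [IsTopologicalGroup G] [CompactSpace G] [MeasurableSpace G] [BorelSpace G] in
/-- The plaquette `((t, 0⃗); 1, 2)` of `(ℤ/N)⁴` is the spatial plaquette `(0⃗; 0, 1)` of the slice at time `t`. -/
theorem plaquette_cons_eq_slice {N : ℕ} (U : GaugeConfig 4 N G) (t : ZMod N) :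
    plaquetteHolonomy U (Fin.cons t (0 : Site 3 N)) 1 2 =
      plaquetteHolonomy (fun q : Edge 3 N => U (Fin.cons t q.1, q.2.succ)) 0 0 1 := by
  have h1 := cons_shift_succ (N := N) t 0 0
  have h2 := cons_shift_succ (N := N) t 0 1
  simp only [Fin.succ_zero_eq_one, Fin.succ_one_eq_two] at h1 h2
  simp only [plaquetteHolonomy, Fin.succ_zero_eq_one, Fin.succ_one_eq_two, h1, h2]

omit [TopologicalSpace G] [IsTopologicalGroup G] [CompactSpace G] [MeasurableSpace G] [BorelSpace G] in
/-- The plaquette `(0; 1, 2)` of `(ℤ/N)⁴` read on the time-zero slice: it is the spatial plaquette `(0; 0, 1)` of slice `0`. -/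
theorem facingPlaquette_fst_eq {N : ℕ} (U : GaugeConfig 4 N G) :
    (ρ (plaquetteHolonomy U 0 1 2)).trace.re =
      (ρ (plaquetteHolonomy (fun q : Edge 3 N => U (Fin.cons (0 : ZMod N) q.1, q.2.succ)) 0 0 1)).trace.re := by
  rw [site_zero_eq_cons, plaquette_cons_eq_slice]

omit [TopologicalSpace G] [IsTopologicalGroup G] [CompactSpace G] [MeasurableSpace G] [BorelSpace G] in
/-- The plaquette `(e₀; 1, 2)` read on the slice `t = 1`: it is the spatial plaquette `(0; 0, 1)` of slice `1`. -/
theorem facingPlaquette_snd_eq {N : ℕ} (U : GaugeConfig 4 N G) :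
    (ρ (plaquetteHolonomy U ((0 : Site 4 N).shift 0) 1 2)).trace.re =
      (ρ (plaquetteHolonomy (fun q : Edge 3 N => U (Fin.cons (1 : ZMod N) q.1, q.2.succ)) 0 0 1)).trace.re := by
  rw [site_shift_zero_eq_cons, plaquette_cons_eq_slice]

end Facing

/-- **The facing-plaquette covariance of the torus Wilson state is the lag-one covariance of the cyclic slice chain.**
For a `LatticeRep r`, `β ≥ 0` and the torus `(ℤ/N)⁴`: with the spatial plaquette `f(V) = Re tr r.ρ(V_{(0;0,1)})`, the kernel
`K_β = wilsonSliceKernel r.ρ β` and `Z = cyclicPartition r.ρ β N N`,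
`∫ P₀P₁ dμ_W − (∫ P₀ dμ_W)(∫ P₁ dμ_W) = I/Z − (J/Z)²`, `I = ∫ ∏K · f(V₀) f(V₁)`, `J = ∫ ∏K · f(V₀)`. [folklore] -/
theorem facingCov_eq_cyclic (r : LatticeRep G) {β : ℝ} (hβ : 0 ≤ β) (N : ℕ) [NeZero N] :
    (∫ U, (r.ρ (plaquetteHolonomy U 0 1 2)).trace.re * (r.ρ (plaquetteHolonomy U ((0 : Site 4 N).shift 0) 1 2)).trace.re
        ∂(wilsonMeasure (d := 4) (L := N) r.ρ β)) -
      (∫ U, (r.ρ (plaquetteHolonomy U 0 1 2)).trace.re ∂(wilsonMeasure (d := 4) (L := N) r.ρ β)) *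
        ∫ U, (r.ρ (plaquetteHolonomy U ((0 : Site 4 N).shift 0) 1 2)).trace.re ∂(wilsonMeasure (d := 4) (L := N) r.ρ β) =
    (∫ V : ZMod N → GaugeConfig 3 N G, (∏ t : ZMod N, wilsonSliceKernel r.ρ β (V t) (V (t + 1))) *
        ((r.ρ (plaquetteHolonomy (V 0) 0 0 1)).trace.re * (r.ρ (plaquetteHolonomy (V 1) 0 0 1)).trace.re)
        ∂(Measure.pi fun _ : ZMod N => Measure.pi fun _ : Edge 3 N => haarProbability G)) / cyclicPartition r.ρ β N N -
      ((∫ V : ZMod N → GaugeConfig 3 N G, (∏ t : ZMod N, wilsonSliceKernel r.ρ β (V t) (V (t + 1))) *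
          (r.ρ (plaquetteHolonomy (V 0) 0 0 1)).trace.re
          ∂(Measure.pi fun _ : ZMod N => Measure.pi fun _ : Edge 3 N => haarProbability G)) / cyclicPartition r.ρ β N N) ^ 2 := by
  haveI : SecondCountableTopology G :=
    (r.continuous.isClosedEmbedding r.injective).isEmbedding.secondCountableTopology
  haveI : IsProbabilityMeasure (haarProbability G) :=
    Literature.RepresentationTheory.CompactGroups.CompactGroup.isProbabilityMeasure_haarMeasure_top
  -- the spatial plaquette function on a slice
  set f : GaugeConfig 3 N G → ℝ := fun V => (r.ρ (plaquetteHolonomy V 0 0 1)).trace.re with hf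
  have hfm : Measurable f := (continuous_trace_re r.ρ r.continuous).measurable.comp (measurable_plaquetteHolonomy 0 0 1)
  have hfb : ∀ V, ‖f V‖ ≤ (Fintype.card (Fin r.N) : ℝ) := fun V => by
    rw [Real.norm_eq_abs]
    exact Literature.RepresentationTheory.CompactGroups.CompactGroup.abs_re_trace_le_card r.ρ r.continuous _
  have hB0 : (0 : ℝ) ≤ (Fintype.card (Fin r.N) : ℝ) := Nat.cast_nonneg _
  -- the three observables as slice functionals
  have e01 : ∀ U : GaugeConfig 4 N G,
      (r.ρ (plaquetteHolonomy U 0 1 2)).trace.re * (r.ρ (plaquetteHolonomy U ((0 : Site 4 N).shift 0) 1 2)).trace.re =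
        (fun W : ZMod N → GaugeConfig 3 N G => f (W 0) * f (W 1)) (fun t q => U (Fin.cons t q.1, q.2.succ)) := fun U => by
    simp only [hf]
    rw [facingPlaquette_fst_eq, facingPlaquette_snd_eq]
  have e0 : ∀ U : GaugeConfig 4 N G, (r.ρ (plaquetteHolonomy U 0 1 2)).trace.re =
      (fun W : ZMod N → GaugeConfig 3 N G => f (W 0)) (fun t q => U (Fin.cons t q.1, q.2.succ)) := fun U => by
    simp only [hf]
    rw [facingPlaquette_fst_eq]
  have e1 : ∀ U : GaugeConfig 4 N G, (r.ρ (plaquetteHolonomy U ((0 : Site 4 N).shift 0) 1 2)).trace.re =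
      (fun W : ZMod N → GaugeConfig 3 N G => f (W 1)) (fun t q => U (Fin.cons t q.1, q.2.succ)) := fun U => by
    simp only [hf]
    rw [facingPlaquette_snd_eq]
  have hm01 : Measurable fun W : ZMod N → GaugeConfig 3 N G => f (W 0) * f (W 1) :=
    (hfm.comp (measurable_pi_apply 0)).mul (hfm.comp (measurable_pi_apply 1))
  have hm0 : Measurable fun W : ZMod N → GaugeConfig 3 N G => f (W 0) := hfm.comp (measurable_pi_apply 0)
  have hm1 : Measurable fun W : ZMod N → GaugeConfig 3 N G => f (W 1) := hfm.comp (measurable_pi_apply 1)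
  have hb01 : ∀ W : ZMod N → GaugeConfig 3 N G, ‖f (W 0) * f (W 1)‖ ≤ (Fintype.card (Fin r.N) : ℝ) * Fintype.card (Fin r.N) :=
    fun W => by rw [norm_mul]; exact mul_le_mul (hfb _) (hfb _) (norm_nonneg _) hB0
  simp_rw [e01, e0, e1]
  rw [integral_wilsonMeasure_sliceFun r hβ N _ hm01 hb01, integral_wilsonMeasure_sliceFun r hβ N _ hm0 (fun W => hfb _),
    integral_wilsonMeasure_sliceFun r hβ N _ hm1 (fun W => hfb _),
    integral_cyclic_insert_one_eq_zero (Measure.pi fun _ : Edge 3 N => haarProbability G) (wilsonSliceKernel r.ρ β) f]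
  ring

end SliceBridge

end Summit.QuantumFields.YangMills.Cruxes.IR.VolumeMonotone

end
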